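import Mathlib
import Summits.ResolutionOfSingularities.ResolutionOfSingularities.Theorems.RadicialJungCleanModelsBirthCorner
import HarnessLib

/-!
# Route `RadicialJung`, crux `CleanModels` (stmt-ResolutionOfSingularities-15917), line `Sketch` rev 35, stub 6 `stub_cleanProp44` (X44c),
# `τ = 1` residual, the corner `λ' ≡ 0` ((B5′) of memo 4e §2.6 (d)): SEPARABLE closed points reduce to rational ones

Seat decomp-res-hand-2 g12 (structural hand); third algebraic brick after ✓ `…BirthDescent.lean` (δ-descent degree count, `F' ≠ 0`) and
✓ `…BirthCorner.lean` (the corner `F' = 0` at `κ(c)`-rational points: maximal-contact normal form, weak descent `ν ≤ δ`, uniqueness of the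
non-descending rational birth).  Here the corner is pushed to the SEPARABLE non-rational closed points `c'` of `Γ'' ≅ ℙ¹_{κ(c)}` (monic irreducible
separable `π ∈ κ(c)[u]`) by base change to a separable extension `L ⊇ κ(c)` containing a root `α` of `π`:

* `births_X_sub_C_pow_dvd_map_of_pow_dvd` — `π^n ∣ D ⟹ (u − α)^n ∣ D_L` (no separability needed).
* `births_map_ne_pow_of_isSeparable` — `F ∉ κ[u]^p ⟹ F ∉ L[u]^p` for `L/κ` separable (`perfectClosure κ L = ⊥`: a `p`-th root of an element of `κ`
  that lies in a separable extension lies in `κ`).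
* `births_corner_not_dvd_of_aeval_eq_zero` — **WEAK DESCENT AT SEPARABLE POINTS**: `F' = 0`, `deg F ≤ p d`, `F ∉ κ[u]^p`, `π(α) = 0` with `α` in a
  separable extension ⟹ `π^{pd+1} ∤ F − G^p` for every `G ∈ κ[u]`, i.e. `ν(c') ≤ δ`.
* `births_corner_aeval_unique` — **non-descending births at separable points are GEOMETRICALLY UNIQUE**: if `π₁^{pd} ∣ F − G₁^p`, `π₂^{pd} ∣ F − G₂^p`
  (`d ≥ 1`) and `α`, `β` are roots of `π₁`, `π₂` in one separable extension, then `α = β`.  Hence (`births_corner_not_dvd_of_aeval_ne`) a `π` with two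
  distinct roots in a separable extension — every separable irreducible `π` of degree `≥ 2`, instantiated in `births_corner_not_dvd_of_separable`
  over the splitting field — is NEVER non-descending: **in the corner, a non-descending birth is a RATIONAL point, and there is at most one.**

What is left of (B5′) after the three bricks (for the planner): (i) INSEPARABLE closed points `π ∈ κ(c)[u^p]` of `Γ''` (there `F − G^p ∈ κ[u^p]` and
`ν(c') = sup_{Γ ∈ κ^p[Y]} ord_{π₀}(Φ − Γ)`, `π = π₀(u^p)`, `F = Φ(u^p)` — a different approximation problem, untouched); (ii) termination of the
unique unbranched chain of rational maximal-contact births `F = P^p + a(u − α)^{δ}` with `δ*` constant (the memo's dissolved example suggests it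
is carried by a curve of `Σ_μ` inside a wiggle of the leaf).  Dictionary and honest framing as in `…BirthDescent.lean`: OURS, elementary field
theory; nothing here proves (B5′), the hypotheses of `cleanProp44_of_tauOneResidual`, X44c, any case of `CleanModels`, or resolution of
singularities in characteristic `p`.  Setting only: [cite: CossartPiltant2008, Lemma 4.3 (5), Prop. 4.4] [cite: CossartJannsenSaito2020, Thm. 4.22, Cor. 4.23].
-/

set_option linter.dupNamespace false -- mandated namespace of this single-conjunct summit

open Polynomial Finset

namespace Summit.ResolutionOfSingularities.ResolutionOfSingularities.Theorems.RadicialJung.CleanModels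

/-! ## §1 Base change to an extension containing a root -/

/-- `π(α) = 0` in `L ⊇ K` and `π^n ∣ D` in `K[u]` give `(u − α)^n ∣ D` in `L[u]`. [folklore] -/
theorem births_X_sub_C_pow_dvd_map_of_pow_dvd {K L : Type*} [Field K] [Field L] [Algebra K L] {π D : K[X]} {α : L}
    (hα : aeval α π = 0) {n : ℕ} (h : π ^ n ∣ D) : (X - C α) ^ n ∣ D.map (algebraMap K L) := by
  have hroot : X - C α ∣ π.map (algebraMap K L) := by
    rw [dvd_iff_isRoot, IsRoot.def, eval_map, ← aeval_def, hα]
  have h' : (π.map (algebraMap K L)) ^ n ∣ D.map (algebraMap K L) := by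
    rw [← Polynomial.map_pow]
    exact map_dvd (algebraMap K L) h
  exact (pow_dvd_pow_of_dvd hroot n).trans h'

/-- **A separable extension creates no new `p`-th powers**: if `F ∈ K[u]` is not a `p`-th power in `K[u]` and `L/K` is separable, then `F` is not a
`p`-th power in `L[u]` (the coefficients of a `p`-th root lie in `perfectClosure K L = ⊥`). [folklore] -/
theorem births_map_ne_pow_of_isSeparable {K L : Type*} [Field K] [Field L] [Algebra K L] [Algebra.IsSeparable K L]
    (p : ℕ) [Fact p.Prime] [CharP K p] [CharP L p] {F : K[X]} (hnot : ∀ H : K[X], F ≠ H ^ p) :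
    ∀ H : L[X], F.map (algebraMap K L) ≠ H ^ p := by
  intro H hH
  have hcoef : ∀ k, ∃ g : K, algebraMap K L g = H.coeff k := by
    intro k
    have h1 : (H ^ p).coeff (p * k) = H.coeff k ^ p := births_coeff_pow_char_mul p H k
    rw [← hH, coeff_map] at h1
    have hmem : H.coeff k ∈ perfectClosure K L := by
      rw [mem_perfectClosure_iff_pow_mem p]
      refine ⟨1, ?_⟩
      rw [pow_one]
      exact RingHom.mem_range.mpr ⟨F.coeff (p * k), h1⟩
    rw [perfectClosure.eq_bot_of_isSeparable, IntermediateField.mem_bot] at hmem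
    exact hmem
  choose g hg using hcoef
  set G : K[X] := ∑ k ∈ Finset.range (H.natDegree + 1), C (g k) * X ^ k with hGdef
  have hGmap : G.map (algebraMap K L) = H := by
    rw [hGdef, Polynomial.map_sum]
    conv_rhs => rw [as_sum_range_C_mul_X_pow H]
    refine Finset.sum_congr rfl fun k _ => ?_
    rw [Polynomial.map_mul, Polynomial.map_pow, map_C, map_X, hg k]
  apply hnot G
  apply map_injective (algebraMap K L) (algebraMap K L).injective
  rw [hH, ← hGmap, Polynomial.map_pow]

/-- Base change keeps a zero derivative. [folklore] -/
theorem births_derivative_map_eq_zero {K L : Type*} [Field K] [Field L] [Algebra K L] {F : K[X]} (hF' : derivative F = 0) :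
    derivative (F.map (algebraMap K L)) = 0 := by
  rw [derivative_map, hF', Polynomial.map_zero]

/-! ## §2 Weak descent and uniqueness at separable closed points -/

/-- **WEAK DESCENT AT SEPARABLE POINTS** (`ν(c') ≤ δ`): `F' = 0`, `deg F ≤ p d`, `F` not a `p`-th power in `K[u]`, `α` a root of `π` in a
separable extension `L/K` ⟹ `π^{pd+1} ∤ F − G^p` for every `G ∈ K[u]`. [folklore] -/
theorem births_corner_not_dvd_of_aeval_eq_zero {K L : Type*} [Field K] [Field L] [Algebra K L] [Algebra.IsSeparable K L]
    (p : ℕ) [Fact p.Prime] [CharP K p] [CharP L p] {F : K[X]} {d : ℕ}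
    (hF' : derivative F = 0) (hdeg : F.natDegree ≤ p * d) (hnot : ∀ H : K[X], F ≠ H ^ p)
    {π : K[X]} {α : L} (hα : aeval α π = 0) (G : K[X]) : ¬ π ^ (p * d + 1) ∣ F - G ^ p := by
  intro h
  have h' := births_X_sub_C_pow_dvd_map_of_pow_dvd hα h
  rw [Polynomial.map_sub, Polynomial.map_pow] at h'
  refine births_corner_not_dvd p (births_derivative_map_eq_zero hF') ?_ (births_map_ne_pow_of_isSeparable p hnot) α
    (G.map (algebraMap K L)) h'
  rw [natDegree_map]
  exact hdeg

/-- **GEOMETRIC UNIQUENESS OF THE NON-DESCENDING BIRTH**: with `F` as above and `d ≥ 1`, if `π₁^{pd} ∣ F − G₁^p` and `π₂^{pd} ∣ F − G₂^p` and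
`α`, `β` are roots of `π₁`, `π₂` in one separable extension `L/K`, then `α = β`. [folklore] -/
theorem births_corner_aeval_unique {K L : Type*} [Field K] [Field L] [Algebra K L] [Algebra.IsSeparable K L]
    (p : ℕ) [Fact p.Prime] [CharP K p] [CharP L p] {F G₁ G₂ : K[X]} {d : ℕ} (hd : 0 < d)
    (hF' : derivative F = 0) (hdeg : F.natDegree ≤ p * d) (hnot : ∀ H : K[X], F ≠ H ^ p)
    {π₁ π₂ : K[X]} {α β : L} (hα : aeval α π₁ = 0) (hβ : aeval β π₂ = 0)
    (h₁ : π₁ ^ (p * d) ∣ F - G₁ ^ p) (h₂ : π₂ ^ (p * d) ∣ F - G₂ ^ p) : α = β := by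
  have h₁' := births_X_sub_C_pow_dvd_map_of_pow_dvd hα h₁
  have h₂' := births_X_sub_C_pow_dvd_map_of_pow_dvd hβ h₂
  rw [Polynomial.map_sub, Polynomial.map_pow] at h₁' h₂'
  refine births_corner_unique p hd (births_derivative_map_eq_zero hF') ?_ (births_map_ne_pow_of_isSeparable p hnot) h₁' h₂'
  rw [natDegree_map]
  exact hdeg

/-- **A point with two distinct geometric branches is never non-descending**: if `π` has two distinct roots `α ≠ β` in a separable extension, then
`π^{pd} ∤ F − G^p`. [folklore] -/
theorem births_corner_not_dvd_of_aeval_ne {K L : Type*} [Field K] [Field L] [Algebra K L] [Algebra.IsSeparable K L]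
    (p : ℕ) [Fact p.Prime] [CharP K p] [CharP L p] {F : K[X]} {d : ℕ} (hd : 0 < d)
    (hF' : derivative F = 0) (hdeg : F.natDegree ≤ p * d) (hnot : ∀ H : K[X], F ≠ H ^ p)
    {π : K[X]} {α β : L} (hα : aeval α π = 0) (hβ : aeval β π = 0) (hne : α ≠ β) (G : K[X]) :
    ¬ π ^ (p * d) ∣ F - G ^ p :=
  fun h => hne (births_corner_aeval_unique p hd hF' hdeg hnot hα hβ h h)

/-! ## §3 Instantiation: separable irreducible points of degree `≥ 2` always descend -/

/-- **IN THE CORNER A NON-DESCENDING BIRTH IS RATIONAL**: for `π ∈ K[u]` separable of degree `≥ 2` (two distinct roots in its splitting field, a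
Galois — hence separable — extension of `K`), `π^{pd} ∤ F − G^p` whenever `F' = 0`, `deg F ≤ p d`, `d ≥ 1` and `F ∉ K[u]^p`. [folklore] -/
theorem births_corner_not_dvd_of_separable {K : Type*} [Field K] (p : ℕ) [Fact p.Prime] [CharP K p] {F : K[X]} {d : ℕ} (hd : 0 < d)
    (hF' : derivative F = 0) (hdeg : F.natDegree ≤ p * d) (hnot : ∀ H : K[X], F ≠ H ^ p)
    {π : K[X]} (hsep : π.Separable) (h2 : 2 ≤ π.natDegree) (G : K[X]) : ¬ π ^ (p * d) ∣ F - G ^ p := by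
  classical
  let L := π.SplittingField
  haveI : IsGalois K L := IsGalois.of_separable_splitting_field hsep
  haveI : CharP L p := (Algebra.charP_iff K L p).mp inferInstance
  have hcard : Fintype.card (π.rootSet L) = π.natDegree := card_rootSet_eq_natDegree hsep (SplittingField.splits π)
  have hπ0 : π ≠ 0 := fun h0 => by rw [h0, natDegree_zero] at h2; omega
  -- two distinct roots
  obtain ⟨a, b, hab⟩ : ∃ a b : π.rootSet L, a ≠ b := by
    have h1 : 1 < Fintype.card (π.rootSet L) := by rw [hcard]; omega
    exact Fintype.exists_pair_of_one_lt_card h1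
  have ha : aeval (a : L) π = 0 := (mem_rootSet.mp a.2).2
  have hb : aeval (b : L) π = 0 := (mem_rootSet.mp b.2).2
  exact births_corner_not_dvd_of_aeval_ne p hd hF' hdeg hnot ha hb (fun h => hab (Subtype.ext h)) G

end Summit.ResolutionOfSingularities.ResolutionOfSingularities.Theorems.RadicialJung.CleanModels
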